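import Summits.QuantumFields.YangMills.Theorems.DiagonalMirrorRPRTwoShiftProbesPinnedDefs
import Summits.QuantumFields.YangMills.Theorems.PencilRigidityWeakCouplingHypercubicLimitRPDiagClusterOfRPSpectral
import HarnessLib

/-!
# Crux `WeakCouplingHypercubicLimitRP` (stmt-QuantumFields-27398), line `Sketch`, door B, R1-side:
# K3 `BudgetDecay` is a THEOREM on the pinned probe — `budgetDecay_of_diagCluster`, and the R1-side chain by name

Helper file (`--supports stmt-QuantumFields-27398 --as helper`) of the crux lead `lead-27398-D1` g3 (docket director-ym g24, O4 WORD 42 (2)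
(p1′) / WORD 44 (1)(e); critic idea-crit-9 g13 verdict #119 PASS-WITH-PRICE, price p-W1).  On the pinned, model-external half of the
two-shift probe (✓ `…DiagonalMirrorRPRTwoShiftProbesPinnedDefs`: `swapShiftPairing`, `probeVariance`, `PinnedProbe`, `TwoShiftProbes.PinnedTo`):

* `sq_integral_le_integral_sq` — the variance of a bounded measurable lifted functional is nonnegative;
* `twoShiftBudget_le_of_diagCluster` — `DiagCluster r sch Δ C` (`0 ≤ Δ`, `0 ≤ C`) gives, for every pinned probe, eventually
  `|P_{n_k}(k) − P_{2n_k}(k)| ≤ 2 e^{−Δ a_k n_k} (Var_k Y_k + C B_k²)` (the two instances `n_k`, `2n_k` of `DiagCluster` on the scheme's own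
  torus `S = L_k`; the thermal floor is absorbed by `n_k ≤ L_k`, the factor `e^{−2Δ a n} ≤ e^{−Δ a n}` by `Var ≥ 0` — p-A2 of #115 dissolved);
* ★ `budgetDecay_of_diagCluster` — K3 `BudgetDecay 𝔭 Δ` for every `𝔭 : TwoShiftProbes 𝔪` pinned to a probe (`𝔭.PinnedTo P C`);
* `budgetDecay_of_rpSpectral` — the same from the AXIS letter `RPSpectral r sch Δ C` via ✓`diagCluster_of_rpSpectral`;
* `oddTwistGap_of_rpSpectral_of_twoShiftLetters` / `slowest_le_exp_of_rpSpectral` — the door-B R1-side chain of record BY NAME: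
  `RPSpectral` + (K1 `CoarseGap ∧ JunkVisible`, K2 `SlowestVisible (Δ/32)` on a PINNED `𝔭`) ⇒ `r_k ≤ e^{−(Δ/8) a_k}` ⇒ R1 `OddTwistGap 𝔪`
  (✓`slowest_le_exp`, ✓`oddTwistGap_of_twoShiftLetters`).

HONEST FRAMING: K3 is soft; the open letters are K1 (wall W-45-coarse) and K2 (wall W-45-vis), and the sandwich-side fields `vis, W, r, j₀, signal`
of `𝔭` still have to be DEFINED from the shifted sandwich on the eigen-package by their owner (WORD 44 (1)(e)).  Nothing about the weak-coupling
behaviour of Wilson's model is proved; D1′, the crux ⟨27398⟩, its heart S6i and the summit are OPEN; the Yang–Mills mass gap is NOT proved here or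
anywhere in the tree.

References: Fröhlich–Israel–Lieb–Simon, CMP 62 (1978) Thm 2.1; Osterwalder–Seiler, Ann. Phys. 110 (1978) §2.
-/

set_option autoImplicit false

noncomputable section

open MeasureTheory Filter Topology
open Literature.MathematicalPhysics.QuantumLattice Literature.MathematicalPhysics.AQFT
  Literature.MathematicalPhysics.QuantumFieldTheory
open Summit.QuantumFields.YangMills.Cruxes.HypercubicLimit.CouplingResponse (RPSpectral)
open Summit.QuantumFields.YangMills.Cruxes.DiagonalMirrorRPR.SignTwistedDiagonalTrace
  (TwoShiftProbes DiagonalSliceModel OddTwistGap CoarseGap JunkVisible SlowestVisible BudgetDecay slowest_le_exp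
    oddTwistGap_of_twoShiftLetters)
open Summit.QuantumFields.YangMills.Cruxes.NT.Reflection (integrable_wilson_of_bdd)

namespace Summit.QuantumFields.YangMills.Cruxes.DiagonalMirrorRPR.SpectralTransfer

section Variance

variable {G : Type} [Group G] [TopologicalSpace G] [IsTopologicalGroup G] [CompactSpace G]
  [MeasurableSpace G] [BorelSpace G] {N : ℕ} (ρ : G →* Matrix (Fin N) (Fin N) ℂ)

/-- **Variances are nonnegative**: `(∫ H(Ũ) dμ)² ≤ ∫ H(Ũ)² dμ` for a bounded measurable functional under Wilson's torus state
(`0 ≤ ∫ (H(Ũ) − m)²`, expanded). [folklore] -/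
theorem sq_integral_le_integral_sq (hρ : Continuous ρ) (β : ℝ) (L : ℕ) [NeZero L]
    {H : LGConfig 4 G → ℝ} (hHm : Measurable H) {B : ℝ} (hHb : ∀ V, |H V| ≤ B) :
    (∫ U, H (torusLift L U) ∂(wilsonMeasure (d := 4) (L := L) ρ β)) ^ 2 ≤
      ∫ U, (H (torusLift L U)) ^ 2 ∂(wilsonMeasure (d := 4) (L := L) ρ β) := by
  haveI := isProbabilityMeasure_wilsonMeasure (d := 4) (L := L) ρ hρ β
  set μ : Measure (GaugeConfig 4 L G) := wilsonMeasure ρ β with hμ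
  set m : ℝ := ∫ U, H (torusLift L U) ∂μ with hm
  have hm1 : Measurable fun U : GaugeConfig 4 L G => H (torusLift L U) := hHm.comp (measurable_torusLift _)
  have hb1 : ∀ U : GaugeConfig 4 L G, |H (torusLift L U)| ≤ B := fun U => hHb _
  have i1 : Integrable (fun U => H (torusLift L U)) μ := integrable_wilson_of_bdd ρ hρ β hm1 ⟨B, hb1⟩
  have i2 : Integrable (fun U => (H (torusLift L U)) ^ 2) μ :=
    integrable_wilson_of_bdd ρ hρ β (hm1.pow_const 2) ⟨B ^ 2, fun U => by
      rw [abs_pow]; exact pow_le_pow_left₀ (abs_nonneg _) (hb1 U) 2⟩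
  have h0 : 0 ≤ ∫ U, (H (torusLift L U) - m) ^ 2 ∂μ := integral_nonneg fun U => sq_nonneg _
  have i3 : Integrable (fun U => (H (torusLift L U)) ^ 2 - 2 * m * H (torusLift L U)) μ := i2.sub (i1.const_mul (2 * m))
  have i4 : Integrable (fun U => 2 * m * H (torusLift L U)) μ := i1.const_mul (2 * m)
  have hexp : ∫ U, (H (torusLift L U) - m) ^ 2 ∂μ = (∫ U, (H (torusLift L U)) ^ 2 ∂μ) - m ^ 2 := by
    have hfun : (fun U : GaugeConfig 4 L G => (H (torusLift L U) - m) ^ 2) =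
        fun U => ((H (torusLift L U)) ^ 2 - 2 * m * H (torusLift L U)) + m ^ 2 := by
      funext U; ring
    rw [hfun, integral_add i3 (integrable_const _), integral_sub i2 i4, integral_const_mul, integral_const, smul_eq_mul,
      probReal_univ, ← hm]
    ring
  linarith

end Variance

section Budget

variable {G : Type} [Group G] [TopologicalSpace G] [IsTopologicalGroup G] [CompactSpace G]
  [MeasurableSpace G] [BorelSpace G] {r : LatticeRep G} {sch : SpeciesScheme (YMSpecies G)}

/-- **The two-shift budget from diagonal clustering.**  `DiagCluster r sch Δ C` (`0 ≤ Δ`, `0 ≤ C`), instantiated on the scheme's own torus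
(`S := L_k`) at the two shifts `n_k` and `2n_k` of a pinned probe, gives eventually
`|P_{n_k}(k) − P_{2n_k}(k)| ≤ 2 e^{−Δ a_k n_k} · (Var_k Y_k + C B_k²)`. [cite: FrohlichIsraelLiebSimon1978, Thm. 2.1] -/
theorem twoShiftBudget_le_of_diagCluster (P : PinnedProbe sch) {Δ C : ℝ} (hΔ : 0 ≤ Δ) (hC : 0 ≤ C)
    (hD : DiagCluster r sch Δ C) :
    ∀ᶠ k in atTop, |swapShiftPairing r sch (P.Y k) (P.n k) k - swapShiftPairing r sch (P.Y k) (2 * P.n k) k| ≤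
      2 * Real.exp (-(Δ * sch.a k * P.n k)) * (probeVariance r sch (P.Y k) k + C * P.B k ^ 2) := by
  unfold DiagCluster at hD
  filter_upwards [hD, P.room] with k hk hroom
  have h1 := hk (sch.L k) (P.T k) (P.n k) le_rfl (by omega) (P.Y k) (P.B k) (P.measurable k) (P.bdd k) (P.boxLocal k)
  have h2 := hk (sch.L k) (P.T k) (2 * P.n k) le_rfl (by omega) (P.Y k) (P.B k) (P.measurable k) (P.bdd k)
    (P.boxLocal k)
  unfold swapShiftPairing probeVariance
  -- the variance is nonnegative
  have hV := sq_integral_le_integral_sq r.ρ r.continuous (sch.β k) (2 * sch.L k + 1) (P.measurable k) (P.bdd k)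
  set Pn : ℝ := ∫ U, P.Y k (torusLift (2 * sch.L k + 1) (configPerm (Equiv.swap (0 : Fin 4) 1) U)) *
      P.Y k (configShift (-Pi.single 0 (P.n k : ℤ) + Pi.single 1 (P.n k : ℤ)) (torusLift (2 * sch.L k + 1) U))
    ∂(wilsonMeasure r.ρ (sch.β k) : Measure (GaugeConfig 4 (2 * sch.L k + 1) G)) with hPn
  set P2n : ℝ := ∫ U, P.Y k (torusLift (2 * sch.L k + 1) (configPerm (Equiv.swap (0 : Fin 4) 1) U)) *
      P.Y k (configShift (-Pi.single 0 ((2 * P.n k : ℕ) : ℤ) + Pi.single 1 ((2 * P.n k : ℕ) : ℤ))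
        (torusLift (2 * sch.L k + 1) U))
    ∂(wilsonMeasure r.ρ (sch.β k) : Measure (GaugeConfig 4 (2 * sch.L k + 1) G)) with hP2n
  set m : ℝ := ∫ U, P.Y k (torusLift (2 * sch.L k + 1) U)
    ∂(wilsonMeasure r.ρ (sch.β k) : Measure (GaugeConfig 4 (2 * sch.L k + 1) G)) with hm
  set v : ℝ := ∫ U, (P.Y k (torusLift (2 * sch.L k + 1) U)) ^ 2
    ∂(wilsonMeasure r.ρ (sch.β k) : Measure (GaugeConfig 4 (2 * sch.L k + 1) G)) with hv
  -- exponent comparisons: `e^{−Δ a (2n)} ≤ e^{−Δ a n}` and `e^{−Δ a L} ≤ e^{−Δ a n}` (`n ≤ L`)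
  have ha0 : 0 ≤ Δ * sch.a k := mul_nonneg hΔ (sch.a_pos k).le
  have hn2 : (P.n k : ℝ) ≤ ((2 * P.n k : ℕ) : ℝ) := by exact_mod_cast (by omega : P.n k ≤ 2 * P.n k)
  have hnL : (P.n k : ℝ) ≤ (sch.L k : ℝ) := by exact_mod_cast (by omega : P.n k ≤ sch.L k)
  have hexp2 : Real.exp (-(Δ * sch.a k * ((2 * P.n k : ℕ) : ℝ))) ≤ Real.exp (-(Δ * sch.a k * P.n k)) := by
    rw [Real.exp_le_exp]; nlinarith
  have hexpL : Real.exp (-(Δ * sch.a k * sch.L k)) ≤ Real.exp (-(Δ * sch.a k * P.n k)) := by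
    rw [Real.exp_le_exp]; nlinarith
  have hCB : 0 ≤ C * P.B k ^ 2 := by positivity
  have hprod1 := mul_le_mul_of_nonneg_right hexp2 (sub_nonneg.2 hV)
  have hprod2 := mul_le_mul_of_nonneg_left hexpL hCB
  calc |Pn - P2n| ≤ |Pn - m ^ 2| + |m ^ 2 - P2n| := abs_sub_le _ _ _
    _ = |Pn - m ^ 2| + |P2n - m ^ 2| := by rw [abs_sub_comm (m ^ 2) P2n]
    _ ≤ (Real.exp (-(Δ * sch.a k * P.n k)) * (v - m ^ 2) + C * P.B k ^ 2 * Real.exp (-(Δ * sch.a k * sch.L k))) +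
        (Real.exp (-(Δ * sch.a k * ((2 * P.n k : ℕ) : ℝ))) * (v - m ^ 2) +
          C * P.B k ^ 2 * Real.exp (-(Δ * sch.a k * sch.L k))) := add_le_add h1 h2
    _ ≤ 2 * Real.exp (-(Δ * sch.a k * P.n k)) * (v - m ^ 2 + C * P.B k ^ 2) := by linarith

variable {𝔪 : DiagonalSliceModel r sch}

/-- ★ **K3 is a theorem on the pinned probe**: for two-shift probe data `𝔭` pinned to `P` with thermal constant `C` (`𝔭.PinnedTo P C`),
`DiagCluster r sch Δ C` (`0 ≤ Δ`, `0 ≤ C`) gives `BudgetDecay 𝔭 Δ`. [cite: FrohlichIsraelLiebSimon1978, Thm. 2.1] -/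
theorem budgetDecay_of_diagCluster (𝔭 : TwoShiftProbes 𝔪) (P : PinnedProbe sch) {Δ C : ℝ} (hpin : 𝔭.PinnedTo P C)
    (hΔ : 0 ≤ Δ) (hC : 0 ≤ C) (hD : DiagCluster r sch Δ C) : BudgetDecay 𝔭 Δ := by
  obtain ⟨hn, hbud, hsc⟩ := hpin
  unfold BudgetDecay
  filter_upwards [twoShiftBudget_le_of_diagCluster P hΔ hC hD] with k hk
  rw [hbud k, hsc k, hn k]
  exact hk

/-- K3 from the AXIS letter: `RPSpectral r sch Δ C` (`0 ≤ Δ`, `0 ≤ C`, `β_k ≥ 0` eventually) gives `BudgetDecay 𝔭 Δ` for every pinned `𝔭`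
(✓`diagCluster_of_rpSpectral` ∘ `budgetDecay_of_diagCluster`). [cite: FrohlichIsraelLiebSimon1978, Thm. 2.1] -/
theorem budgetDecay_of_rpSpectral (𝔭 : TwoShiftProbes 𝔪) (P : PinnedProbe sch) {Δ C : ℝ} (hpin : 𝔭.PinnedTo P C)
    (hΔ : 0 ≤ Δ) (hC : 0 ≤ C) (hβ : ∀ᶠ k in atTop, 0 ≤ sch.β k) (hRP : RPSpectral r sch Δ C) : BudgetDecay 𝔭 Δ :=
  budgetDecay_of_diagCluster 𝔭 P hpin hΔ hC (diagCluster_of_rpSpectral r sch Δ C hΔ hC hβ hRP)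

/-- **The door-B R1-side chain of record by name, slowest-modulus form**: the AXIS letter `RPSpectral` + K1 `CoarseGap ∧ JunkVisible` + K2
`SlowestVisible (Δ/32)` on a PINNED two-shift probe ⇒ `r_k ≤ e^{−(Δ/8) a_k}` eventually (✓`slowest_le_exp`). [cite: FrohlichIsraelLiebSimon1978, Thm. 2.1] -/
theorem slowest_le_exp_of_rpSpectral (𝔭 : TwoShiftProbes 𝔪) (P : PinnedProbe sch) {Δ C : ℝ} {M : ℕ → ℝ}
    (hpin : 𝔭.PinnedTo P C) (hΔ : 0 < Δ) (hC : 0 ≤ C) (hβ : ∀ᶠ k in atTop, 0 ≤ sch.β k) (hRP : RPSpectral r sch Δ C)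
    (hM : Tendsto M atTop atTop) (hgap : CoarseGap 𝔭 M) (hjunk : JunkVisible 𝔭 M) (hvis : SlowestVisible 𝔭 (Δ / 32)) :
    ∀ᶠ k in atTop, 𝔭.r k ≤ Real.exp (-(Δ / 8 * sch.a k)) :=
  slowest_le_exp 𝔭 hΔ hM hgap hjunk hvis (budgetDecay_of_rpSpectral 𝔭 P hpin hΔ.le hC hβ hRP)

/-- ★ **The door-B R1-side chain of record by name**: `RPSpectral r sch Δ C` (`Δ > 0`, `C ≥ 0`, `β_k ≥ 0` eventually) + K1 `CoarseGap 𝔭 M ∧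
JunkVisible 𝔭 M` (`M_k → ∞`) + K2 `SlowestVisible 𝔭 (Δ/32)` on a PINNED two-shift probe of a diagonal slice model `𝔪` ⇒ R1 `OddTwistGap 𝔪`
(✓`diagCluster_of_rpSpectral`, `budgetDecay_of_diagCluster`, ✓`oddTwistGap_of_twoShiftLetters`).  The open content is K1, K2 and the
definition of the sandwich side of `𝔭`. [cite: FrohlichIsraelLiebSimon1978, Thm. 2.1] -/
theorem oddTwistGap_of_rpSpectral_of_twoShiftLetters (𝔭 : TwoShiftProbes 𝔪) (P : PinnedProbe sch) {Δ C : ℝ} {M : ℕ → ℝ}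
    (hpin : 𝔭.PinnedTo P C) (hΔ : 0 < Δ) (hC : 0 ≤ C) (hβ : ∀ᶠ k in atTop, 0 ≤ sch.β k) (hRP : RPSpectral r sch Δ C)
    (hM : Tendsto M atTop atTop) (hgap : CoarseGap 𝔭 M) (hjunk : JunkVisible 𝔭 M) (hvis : SlowestVisible 𝔭 (Δ / 32)) :
    OddTwistGap 𝔪 :=
  oddTwistGap_of_twoShiftLetters 𝔭 hΔ hM hgap hjunk hvis (budgetDecay_of_rpSpectral 𝔭 P hpin hΔ.le hC hβ hRP)

end Budget

end Summit.QuantumFields.YangMills.Cruxes.DiagonalMirrorRPR.SpectralTransfer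

end
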